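import Literature.NumberTheory.EllipticCurves.SingularModuliClassGroupActionOrder
import Literature.NumberTheory.EllipticCurves.HeegnerPointsHeckeOrbitOrders
import Literature.NumberTheory.EllipticCurves.HeegnerPointsLevelTransportOrders
import Literature.NumberTheory.QuadraticFields.AmbiguousClassesOrder
import Summits.BirchSwinnertonDyer.BirchSwinnertonDyer.Theorems.SylvesterTwoHeegnerIndexLevelFixingTransportToFix
import Summits.BirchSwinnertonDyer.BirchSwinnertonDyer.Theorems.SylvesterTwoHeegnerIndexLevelFixingLevelFormFactorisation
import HarnessLib

/-!
# (W2-b) AT `n = 1` ON THE W-CLASS `p ≡ 25 (mod 27)`, NAME-FREE: every `K`-involution of `K[9p]` fixes Hu–Shu–Yin's point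
# `y₁ = φ(τ)` — from the `w₂₄₃`-half of HSY Prop. 2.1 (1) ALONE (route (4.1) of the seat memo, assembled)
# (crux `UpperOffV0HSYPlus`, stmt-BirchSwinnertonDyer-19804; route `SylvesterTwoHeegnerIndex`, rung K7t)

Cell `bsd-cm`, seat `bsd-cm-k7t-c2` g32 ((W2-b) seat of record, planner D815/D816: «(4.1) `hW2b₁` first»).  Helper toward
`stmt-BirchSwinnertonDyer-19804` (`--supports … --as helper`).  THEOREMS ONLY (no definition, no named fact, no instance, no
`sorry`).

WHAT.  `hW2b₁` (the `n = 1` clause of `stub_levelFixingSeven`, = the input of THEOREM C `stub_thmC`/item 19802 via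
`thmC_of_named_of_levelInvolutionFixing`, p691380) says: the decomposition involution at `w = (√−3)` of `K[9p]/K` fixes every point
`y ∈ E₉(K[9p])` over `Dt.φ(τ)`, `τ` = Hu–Shu–Yin's CM point of conductor `9p` on `X₀(3⁵)`.  THIS FILE PROVES IT ON THE CLASS
`p ≡ 25 (mod 27)` — indeed for EVERY `K`-automorphism `φ` of `K[9p]` with `φ² = 1`, not only the one coming from `D_w` — from
ONE displayed print input, the `w₂₄₃`-invariance `hW` of the degree-6 parametrisation (HSY Prop. 2.1 (1) = (G3), admitted as a
print binder by planner D816, typed by k-ty1 as `IsS3Invariant.frickeGL_smul`, p749218), and tree theorems: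

  ★ `involution_fixes_sylvesterPoint_W` : `Dt` with `hW`, `p` prime, `p ≡ 7 (9)`, `p ≡ 25 (27)`, `K ∋ ω`, `ι`,
    `φ : K[9p·1] ≃ₐ[K] K[9p·1]` with `φ * φ = 1`, `y` over `Dt.φ(τ)` ⊢ `pointGalHom E₉ K[9p·1] (φ.restrictScalars ℚ) y = y`.

PROOF (memo `W2B-RECIPROCITY-k7t-c2-g32.md` v2 §4.1/§4.4, name-free; no class field theory, no Artin symbol):
(1) `φ = 1`: trivial (descent `pointGalHom_eq_self_of_forall_ringEquiv`, p749244).  (2) `φ ≠ 1`: for every `σ ∈ Aut(ℂ)` extending `φ`,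
`σ` fixes `ι(K)` hence `√(−243p²)`; by HASSE'S TRANSLATION LAW FOR THE ORDER of discriminant `−243p²` (k-ty1 g16,
`exists_translation_classJ`, `SingularModuliClassGroupActionOrder`, CFT-free) `σ(j(κ)) = j(η·κ)` for one class `η`; `η² = 1`
because `σ²` extends `φ² = 1` and the `j(κ)` lie in `K[9p]` (`formJ_mem_ringClassField`); `η ≠ 1` because otherwise `σ` fixes
`j(τ)` and then all of `K[9p]` (`eqOn_ringClassField_of_apply_formJ_eq`), i.e. `φ = 1`; the class group of discriminant
`−243p²` has EXACTLY TWO classes of order `≤ 2` (Cox Prop. 3.11 in the tree, `natCard_sq_eq_one_classGroup_QO`, `μ = 2` assigned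
characters: the primes `3`, `p`), and the level class `[𝔫₁] = [(243, B, (A/243)C)]` is a non-trivial one
(`classOf'_sylvester_levelForm_sq_eq_one` / `_ne_one`, p749469) — so `η = [𝔫₁]`; by the `w_N`-formula `[fricke 243 Q] · [𝔫₁] = [Q]`
(`classOf'_fricke_sylvester`, p749469) `σ(j(τ)) = j(τ_{fricke 243 Q})`; the Bezout ENGINE (`levelTransport_of_transport_lattice_eq_bezout`,
same residue by `fricke_sylvesterForm_residue`, p748618) upgrades this to `LevelTransport 243 σ τ τ_{fricke 243 Q}`; and
`levelFixing_of_levelTransport_fricke` (p749244: `isAutEquivariantOnHeegner` + `hW` + descent) concludes.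

HONEST LABEL: CONDITIONAL on the displayed print input `hW` only; covers ONE of the three classes of `p ≡ 7 (mod 9)` modulo `27`
(on `p ≡ 7, 16 (27)` the partner is `A^{±1}W·τ` and the `A`-half of (G3) enters — sequel); no stub closed on the ledger (the
registered `stub_levelFixingSeven` quantifies over all `p ≡ 7 (9)` and all levels `n`); nothing asserted on 19804; X12.CMAtTwo
NOT proved; BSD is proved for no curve.

## References
* Y. Hu, J. Shu, H. Yin, Trans. AMS 372 (2019) = arXiv:1708.05266, §2.1 Prop. 2.1 (1), §2.2 Thm 2.2–2.3, §4.1. [HuShuYin2019]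
* D. A. Cox, *Primes of the form x² + ny²*, 2nd ed. (2013), §3.A Prop. 3.11, §7.B Thm. 7.7, §11.D Cor. 11.37. [Cox2013]
* B. H. Gross, *Heegner points on `X₀(N)`* (1984), §I.1, §5. [Gross1984]
* H. Darmon, CBMS 101 (2004), Thm. 3.6–3.7. [Darmon2004]
-/

set_option autoImplicit false
-- the Summit-side namespace `Summit.BirchSwinnertonDyer.BirchSwinnertonDyer.…` (summit = problem) is mandated by D-0017
set_option linter.dupNamespace false

noncomputable section

open scoped Classical Cardinal

namespace Summit.BirchSwinnertonDyer.BirchSwinnertonDyer.Theorems.SylvesterTwoLevelFixingBottom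

open Literature.NumberTheory.EllipticCurves Literature.NumberTheory.EllipticCurves.HeegnerForm
  Literature.NumberTheory.EllipticCurves.HuShuYin2019 Literature.NumberTheory.EllipticCurves.ModularForms
  Literature.NumberTheory.QuadraticFields.BinaryQuadraticForm Literature.NumberTheory.QuadraticFields.Quadratic
  Literature.Computability.Cryptography.Hallgren2005 Literature.Computability.Cryptography.Hallgren2005.OrderCl
  PeriodPair WeierstrassCurve Literature.NumberTheory.ComplexMultiplication.CMTypeLattice
  Summit.BirchSwinnertonDyer.BirchSwinnertonDyer.Theorems.SylvesterTwoLevelFixingGlue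
  Summit.BirchSwinnertonDyer.BirchSwinnertonDyer.Theorems.SylvesterTwoLevelFixingClass
  Summit.BirchSwinnertonDyer.BirchSwinnertonDyer.Theorems.SylvesterTwoLevelFixingOrbit

variable {K : Type} [Field K] [NumberField K]

/-- The class group of discriminant `−243p²` (`p` a prime `≠ 2, 3`) has exactly TWO classes of order `≤ 2`: Cox Prop. 3.11 with
`μ = #{3, p} = 2` assigned characters (`D ≡ 1 (mod 4)`). [cite: Cox2013, §3.A Prop. 3.11] -/
theorem natCard_sq_eq_one_sylvester (Δ : NegDiscr) {p : ℕ} (hpr : p.Prime) (hp2 : p ≠ 2) (hp3 : p ≠ 3)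
    (hΔ : Δ.D = ((9 * p * 1 : ℕ) : ℤ) ^ 2 * (-3)) :
    Nat.card {c : ClassGroup (QO Δ) // c ^ 2 = 1} = 2 := by
  have hodd : p % 2 = 1 := by
    rcases hpr.eq_two_or_odd with h | h
    · exact absurd h hp2
    · exact h
  have hD1 : Δ.D % 4 = 1 := by
    obtain ⟨t, ht⟩ : ∃ t : ℕ, p = 2 * t + 1 := ⟨p / 2, by omega⟩
    have hD : Δ.D = 4 * (-(243 * (t : ℤ) ^ 2) - 243 * t - 61) + 1 := by rw [hΔ, ht]; push_cast; ring
    omega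
  have hD4 : Δ.D % 4 = 0 ∨ Δ.D % 4 = 1 := Or.inr hD1
  rw [natCard_sq_eq_one_classGroup_QO Δ hD4, assignedCharCount_of_mod_four_eq_one hD1]
  have hnat : Δ.D.natAbs = 3 ^ 5 * p ^ 2 := by
    rw [hΔ]; push_cast
    rw [show ((9 : ℤ) * p * 1) ^ 2 * (-3) = -((3 : ℤ) ^ 5 * p ^ 2) by ring, Int.natAbs_neg]
    exact_mod_cast Int.natAbs_natCast (3 ^ 5 * p ^ 2)
  rw [hnat, Nat.primeFactors_mul (by norm_num) (pow_ne_zero 2 hpr.ne_zero), Nat.primeFactors_prime_pow (by norm_num) Nat.prime_three,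
    Nat.primeFactors_prime_pow two_ne_zero hpr]
  have h23 : (2 : ℕ) ∉ ({3} ∪ {p} : Finset ℕ) := by
    simp only [Finset.mem_union, Finset.mem_singleton, not_or]; omega
  rw [Finset.erase_eq_of_notMem h23, ← Finset.insert_eq, Finset.card_pair (Ne.symm hp3)]
  norm_num

/-- In a group with exactly two elements of square `1`, two non-trivial such elements coincide. [folklore] -/
theorem eq_of_sq_eq_one_of_natCard_two {G : Type*} [Group G] (h2 : Nat.card {c : G // c ^ 2 = 1} = 2)
    {x y : G} (hx : x ^ 2 = 1) (hy : y ^ 2 = 1) (hx1 : x ≠ 1) (hy1 : y ≠ 1) : x = y := by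
  by_contra hxy
  haveI : Finite {c : G // c ^ 2 = 1} := Nat.finite_of_card_ne_zero (by rw [h2]; norm_num)
  let f : Fin 3 → {c : G // c ^ 2 = 1} := ![⟨1, one_pow 2⟩, ⟨x, hx⟩, ⟨y, hy⟩]
  have hf : Function.Injective f := by
    intro i j hij
    fin_cases i <;> fin_cases j <;> simp_all [f]
  have := Nat.card_le_card_of_injective f hf
  simp [h2] at this

/-- ★ **(W2-b) at `n = 1` on the class `p ≡ 25 (mod 27)`, name-free, from the `w₂₄₃`-invariance of the degree-6 parametrisation
alone.**  For every parametrisation datum `Dt` of `E₉ = ⟨0,0,1,0,−1⟩` at level `3⁵` whose `Dt.φ` is `w₂₄₃`-invariant (`hW`: the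
W-half of HSY Prop. 2.1 (1) — DISPLAYED PRINT INPUT), every prime `p ≡ 7 (mod 9)` with `p ≡ 25 (mod 27)`, `K ∋ ω`
(`ω² + ω + 1 = 0`, `[K:ℚ] = 2`), `ι : K → ℂ`, EVERY `K`-automorphism `φ` of `K[9p] = ringClassField K ι (9·p·1)` with `φ² = 1`,
and every `y ∈ E₉(K[9p])` over `Dt.φ(τ)` (`τ` = HSY's CM point of conductor `9p`, the root of
`(81(p²+4p+16), −9(4p²+17p+72), 4p²+18p+81)`): `φ · y = y`.  In particular the decomposition involution at `w = (√−3)` fixes `y₁`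
— `hW2b₁` on this class.  Proof in the module docstring (translation law for the order of discriminant `−243p²`, two
ambiguous classes, the `w_N`-formula without `gcd(N, D) = 1`, the Bezout engine, `isAutEquivariantOnHeegner`, descent).
CONDITIONAL on `hW`; no ledger stub is closed by this file; BSD is proved for no curve.
[cite: HuShuYin2019, §2.1 Prop. 2.1 (1), §2.2 Thm 2.2–2.3, §4.1] [cite: Cox2013, §3.A Prop. 3.11, §11.D Cor. 11.37]
[cite: Gross1984, §I.1, §5] [cite: Darmon2004, Thm. 3.6–3.7] -/
theorem involution_fixes_sylvesterPoint_W
    (Dt : ModularParametrizationData (⟨0, 0, 1, 0, -1⟩ : WeierstrassCurve ℚ) 243)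
    (hW : ∀ τ : UpperHalfPlane, Dt.φ (glCast (frickeGL 243 : GL (Fin 2) ℚ) • τ) = Dt.φ τ)
    {p : ℕ} (hpr : p.Prime) (h9 : p % 9 = 7) (h27 : p % 27 = 25) {ω : K} (hω : ω ^ 2 + ω + 1 = 0)
    (h2 : Module.finrank ℚ K = 2) (ι : K →+* ℂ)
    (φ : ringClassField K ι (9 * p * 1) ≃ₐ[K] ringClassField K ι (9 * p * 1)) (hφ2 : φ * φ = 1)
    (y : (((⟨0, 0, 1, 0, -1⟩ : WeierstrassCurve ℚ)).baseChange (ringClassField K ι (9 * p * 1))).toAffine.Point)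
    (hy : Affine.Point.map (W' := (⟨0, 0, 1, 0, -1⟩ : WeierstrassCurve ℚ))
        (ringClassField K ι (9 * p * 1)).subtype.toRatAlgHom y =
      Dt.φ (heegnerTau (((1 : ℕ) : ℤ) ^ 2 * (81 * ((p : ℤ) ^ 2 + 4 * p + 16)),
        ((1 : ℕ) : ℤ) * (-(9 * (4 * (p : ℤ) ^ 2 + 17 * p + 72))), 4 * (p : ℤ) ^ 2 + 18 * p + 81))) :
    pointGalHom (⟨0, 0, 1, 0, -1⟩ : WeierstrassCurve ℚ) (ringClassField K ι (9 * p * 1)) (φ.restrictScalars ℚ) y = y := by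
  have hK : IsImaginaryQuadratic K := JZero.isImaginaryQuadratic_of_sq_add_self_add_one hω h2
  have hdK : NumberField.discr K = -3 := JZero.discr_eq_neg_three_of_sq_add_self_add_one hω h2
  have hp3 : p % 3 = 1 := by omega
  have hp27 : 27 ≤ p := by
    by_contra h
    have : p = 25 := by omega
    exact absurd hpr (by rw [this]; norm_num)
  have hpne3 : p ≠ 3 := by omega
  have hpne2 : p ≠ 2 := by omega
  have hodd : p % 2 = 1 := by
    rcases hpr.eq_two_or_odd with h | h
    · exact absurd h hpne2
    · exact h
  have hm : 9 * p * 1 ≠ 0 := by positivity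
  have hn3 : ¬ 3 ∣ (1 : ℕ) := by omega
  have hprimes : ∀ q ∈ (1 : ℕ).primeFactors, q % 3 = 2 := by simp [Nat.primeFactors_one]
  have hnC := isCoprime_C_of_forall_prime_mod_three_eq_two (p := p) one_ne_zero hprimes
  -- the objects: HSY's form `Q`, its Fricke partner, the discriminant datum `Δ`
  set Q : ℤ × ℤ × ℤ := (((1 : ℕ) : ℤ) ^ 2 * (81 * ((p : ℤ) ^ 2 + 4 * p + 16)),
    ((1 : ℕ) : ℤ) * (-(9 * (4 * (p : ℤ) ^ 2 + 17 * p + 72))), 4 * (p : ℤ) ^ 2 + 18 * p + 81) with hQdef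
  have hQ : Q ∈ heegnerForms 243 (((9 * p * 1 : ℕ) : ℤ) ^ 2 * (-3)) := sylvesterForm_mem_heegnerForms hp3 one_ne_zero hnC
  have hQ' : fricke 243 Q ∈ heegnerForms 243 (((9 * p * 1 : ℕ) : ℤ) ^ 2 * (-3)) :=
    fricke_sylvesterForm_mem_heegnerForms hp3 one_ne_zero hn3 hnC
  have hD0 : ((9 * p * 1 : ℕ) : ℤ) ^ 2 * (-3) < 0 := by
    have h9 : (0 : ℤ) < ((9 * p * 1 : ℕ) : ℤ) := by exact_mod_cast Nat.pos_of_ne_zero hm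
    nlinarith
  obtain ⟨Δ, hΔ⟩ : ∃ Δ : NegDiscr, Δ.D = ((9 * p * 1 : ℕ) : ℤ) ^ 2 * (-3) := ⟨⟨_, hD0⟩, rfl⟩
  have hΔK : Δ.D = ((9 * p * 1 : ℕ) : ℤ) ^ 2 * NumberField.discr K := by rw [hΔ, hdK]
  have hD4 : Δ.D % 4 = 0 ∨ Δ.D % 4 = 1 := by
    right
    obtain ⟨t, ht⟩ : ∃ t : ℕ, p = 2 * t + 1 := ⟨p / 2, by omega⟩
    have hD : Δ.D = 4 * (-(243 * (t : ℤ) ^ 2) - 243 * t - 61) + 1 := by rw [hΔ, ht]; push_cast; ring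
    omega
  -- case `φ = 1`
  by_cases hφ1 : φ = 1
  · subst hφ1
    refine pointGalHom_eq_self_of_forall_ringEquiv hK ι hm _ 1 y fun σ hσ ↦ ?_
    rw [Affine.Point.map_map]
    exact Affine.Point.map_congr_fun (fun x ↦ by simpa using hσ x) _
  -- case `φ ≠ 1`: every `σ` extending `φ` level-transports `τ` to the Fricke partner
  refine levelFixing_of_levelTransport_fricke Dt hW hp3 hω h2 ι one_ne_zero hprimes φ ?_ y hy
  intro σ hσ
  have hσK : ∀ k : K, σ (ι k) = ι k := ringEquiv_apply_eq_of_extends ι (9 * p * 1) φ hσ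
  have hσ3 : σ (sqrtDisc (-3)) = sqrtDisc (-3) := by
    have h := apply_sqrtDisc_discr_eq hK ι hσK
    rwa [hdK] at h
  have hσD : σ (sqrtDisc Δ.D) = sqrtDisc Δ.D := by
    rw [hΔ, sqrtDisc_sq_mul, map_mul, map_natCast, hσ3]
  -- Hasse's translation law for the order of discriminant `−243p²`
  obtain ⟨η, hη⟩ := exists_translation_classJ Δ hD4 hσD
  -- every `j(κ)` lies in `K[9p]`
  have hmem : ∀ κ : ClassGroup (QO Δ), classJ Δ κ ∈ ringClassField K ι (9 * p * 1) := by
    intro κ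
    obtain ⟨g, hg, -, rfl⟩ := exists_isReduced_classOf'_eq_of_emod_four Δ hD4 κ
    rw [classJ_classOf' hg]
    refine formJ_mem_ringClassField ι hg.a_pos ((isPrimitive_iff_binQF _).mpr hg.primitive) ?_ (hΔK ▸ Δ.neg)
    exact hg.disc_eq.trans hΔK
  -- `σ ∘ σ = id` on `K[9p]`, hence `η² = 1`
  have hσσ : ∀ x : ringClassField K ι (9 * p * 1), σ (σ x) = x := by
    intro x
    rw [hσ x, hσ (φ x), ← AlgEquiv.mul_apply, hφ2, AlgEquiv.one_apply]
  have hη2 : η ^ 2 = 1 := by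
    have h : classJ Δ (η * (η * 1)) = classJ Δ 1 := by
      rw [← hη, ← hη, hσσ ⟨classJ Δ 1, hmem 1⟩]
    have := classJ_injective hD4 h
    rw [mul_one] at this
    rw [sq, this]
  -- `η ≠ 1`: otherwise `σ` fixes `j(τ)`, hence `K[9p]`, hence `φ = 1`
  have hQpp : (⟨Q.1, Q.2.1, Q.2.2⟩ : BinQF).IsPosPrim Δ.D :=
    ⟨by rw [hΔ]; exact hQ.1, hQ.2.1, (BinQF.isPrimitive_iff _).mpr hQ.2.2.2⟩
  have hη1 : η ≠ 1 := by
    intro hη1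
    have hjQ : σ (formJ Q) = formJ Q := by
      have h := hη (classOf' Δ ⟨Q.1, Q.2.1, Q.2.2⟩)
      rw [hη1, one_mul, classJ_classOf' hQpp] at h
      exact h
    have hprimQ : IsPrimitive Q := (isPrimitive_iff_binQF Q).mpr ((BinQF.isPrimitive_iff _).mpr hQ.2.2.2)
    have hdiscQ : discr Q = ((9 * p * 1 : ℕ) : ℤ) ^ 2 * NumberField.discr K := by rw [hdK]; exact hQ.1
    have heq : Set.EqOn (σ : ℂ →+* ℂ) (RingHom.id ℂ) (ringClassField K ι (9 * p * 1)) :=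
      eqOn_ringClassField_of_apply_formJ_eq hK ι hm hQ.2.1 hprimQ hdiscQ
        (fun k ↦ by simpa using hσK k) (by simpa using hjQ)
    apply hφ1
    refine AlgEquiv.ext fun x ↦ Subtype.ext ?_
    have h1 : σ x = x := heq x.2
    rw [hσ x] at h1
    simpa using h1
  -- the level class `ν = [𝔫₁]` is the other class of order `≤ 2`, so `η = ν`
  have hnf := isPosPrim_sylvester_levelForm (p := p) (n := 1) hp3 one_ne_zero hn3 hnC
  rw [← hΔ] at hnf
  have hν2 := classOf'_sylvester_levelForm_sq_eq_one Δ h27 hnf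
  have hν1 := classOf'_sylvester_levelForm_ne_one Δ h27 hp27 hodd hΔ hnf
  have h2cl := natCard_sq_eq_one_sylvester Δ hpr hpne2 hpne3 hΔ
  have hην : η = classOf' Δ ⟨((243 : ℕ) : ℤ), ((1 : ℕ) : ℤ) * (-(9 * (4 * (p : ℤ) ^ 2 + 17 * p + 72))),
      ((1 : ℕ) : ℤ) ^ 2 * (81 * ((p : ℤ) ^ 2 + 4 * p + 16)) / 243 * (4 * (p : ℤ) ^ 2 + 18 * p + 81)⟩ :=
    eq_of_sq_eq_one_of_natCard_two h2cl hη2 hν2 hη1 hν1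
  -- `w_N`-formula: `[fricke Q]·[𝔫₁] = [Q]`, so `σ(j(τ_Q)) = j(η·[Q]) = j([fricke Q]) = j(τ_{fricke Q})`
  have hfac := classOf'_fricke_sylvester Δ (p := p) (n := 1) hp3 one_ne_zero hn3 hnC hΔ
  have hQ'pp : (⟨(fricke 243 Q).1, (fricke 243 Q).2.1, (fricke 243 Q).2.2⟩ : BinQF).IsPosPrim Δ.D :=
    ⟨by rw [hΔ]; exact hQ'.1, hQ'.2.1, (BinQF.isPrimitive_iff _).mpr hQ'.2.2.2⟩
  have hcl : η * classOf' Δ ⟨Q.1, Q.2.1, Q.2.2⟩ = classOf' Δ ⟨(fricke 243 Q).1, (fricke 243 Q).2.1, (fricke 243 Q).2.2⟩ := by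
    rw [hην, ← hfac]
    set ν := classOf' Δ ⟨((243 : ℕ) : ℤ), ((1 : ℕ) : ℤ) * (-(9 * (4 * (p : ℤ) ^ 2 + 17 * p + 72))),
      ((1 : ℕ) : ℤ) ^ 2 * (81 * ((p : ℤ) ^ 2 + 4 * p + 16)) / 243 * (4 * (p : ℤ) ^ 2 + 18 * p + 81)⟩
    have hνν : ν * ν = 1 := by rw [← sq]; exact hν2
    calc ν * (classOf' Δ ⟨(fricke 243 Q).1, (fricke 243 Q).2.1, (fricke 243 Q).2.2⟩ * ν)
        = classOf' Δ ⟨(fricke 243 Q).1, (fricke 243 Q).2.1, (fricke 243 Q).2.2⟩ * (ν * ν) := by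
          rw [mul_comm, mul_assoc]
      _ = _ := by rw [hνν, mul_one]
  have hj : σ (formJ Q) = formJ (fricke 243 Q) := by
    have h := hη (classOf' Δ ⟨Q.1, Q.2.1, Q.2.2⟩)
    rw [classJ_classOf' hQpp, hcl, classJ_classOf' hQ'pp] at h
    exact h
  -- the Bezout ENGINE: `LevelTransport 243 σ τ_Q τ_{fricke Q}`
  obtain ⟨M, hM⟩ := exists_isTransportedBy σ (ofUpperHalfPlane (heegnerTau Q))
  have hjM : (ofUpperHalfPlane (heegnerTau (fricke 243 Q))).j = M.j := by
    rw [hM.j_eq, ← formJ_def, ← formJ_def, hj]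
  obtain ⟨c₀, hc₀, hMc⟩ := exists_lattice_eq_mulLeft_of_j_eq hjM
  -- Bezout datum: `β = B`, `c = (A/243)·C`, `u·243 + 0·β + w·c = 1`
  have hQ2 := hQ
  obtain ⟨hdisc, -, hNA, -⟩ := hQ2
  have hNA' : (243 : ℤ) ∣ Q.1 := by exact_mod_cast hNA
  have hc : 4 * ((243 : ℕ) : ℤ) * (Q.1 / 243 * Q.2.2) = Q.2.1 ^ 2 - (((9 * p * 1 : ℕ) : ℤ) ^ 2 * (-3)) := by
    rw [← hdisc, show (4 : ℤ) * ((243 : ℕ) : ℤ) * (Q.1 / 243 * Q.2.2) = 4 * (Q.1 / 243 * 243) * Q.2.2 by push_cast; ring,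
      Int.ediv_mul_cancel hNA']
    ring
  have hcop : IsCoprime (243 : ℤ) (Q.1 / 243 * Q.2.2) := by
    rw [show (243 : ℤ) = 3 ^ 5 by norm_num]
    apply IsCoprime.pow_left
    rw [Prime.coprime_iff_not_dvd Int.prime_three]
    intro h3
    rcases Int.prime_three.dvd_or_dvd h3 with h | h
    · exact three_not_dvd_sylvesterA_div (n := 1) hp3 hn3 h
    · exact three_not_dvd_C hp3 h
  obtain ⟨u, w, huw⟩ := hcop
  have huvw : u * ((243 : ℕ) : ℤ) + 0 * Q.2.1 + w * (Q.1 / 243 * Q.2.2) = 1 := by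
    push_cast; linear_combination huw
  have hres : (fricke 243 Q).2.1 ≡ Q.2.1 [ZMOD 2 * (243 : ℕ)] := fricke_sylvesterForm_residue h27 ((1 : ℕ) : ℤ)
  exact levelTransport_of_transport_lattice_eq_bezout hD0 hc huvw (hΔ ▸ hσD) hQ (Int.ModEq.refl _) hQ' hres hM hc₀ hMc

end Summit.BirchSwinnertonDyer.BirchSwinnertonDyer.Theorems.SylvesterTwoLevelFixingBottom

end
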